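import Summits.ABC.ABC.Theses.DefiniteXi
import Literature.NumberTheory.Automorphic.BCDTModularity
import Literature.NumberTheory.EllipticCurves.X1ElevenFiveIsogeny
import HarnessLib

/-!
# `FreyModularity` (stmt-ABC-11340), line `Sketch` — stub `stub_switch` needs its hypotheses on `ρ̄`

Negative support for crux stmt-ABC-11340 (`Summit.ABC.ABC.Theses.DefiniteXi.FreyModularity`), written by
the crux disprover (`refuter-cdisprove-stmt-ABC-11340-0`, 2026-08-16, `Cruxes/FreyModularity/Disproof.lean`
finding B1).  The picked line `Sketch` (`Cruxes/FreyModularity/Lines/Sketch.lean`) has the stub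

  `stub_switch : ∀ ρ̄ : Γ_ℚ →ₜ* GL₂(𝔽₅), ρ̄ absolutely irreducible → det ρ̄ = χ̄₅ →
     ∃ E'/ℚ elliptic, E'[5] ≅ ρ̄ ∧ ∃ ρ̄₃ = E'[3], ρ̄₃ surjective`

(Wiles' `3`–`5` switch in the Shepherd-Barron–Taylor form; true in print).  This file proves that the
statement with the two hypotheses on `ρ̄` dropped is FALSE: the trivial representation `ρ̄ = 1` is `E[5]`
of no elliptic curve over `ℚ`, because the Weil pairing forces `det ρ̄_{E,5} = χ̄₅` (the tree's theorem
`WeierstrassCurve.det_eq_modPCyclotomicCharacter_of_isTorsionGaloisRep_holds`) and `χ̄₅ ≢ 1` on `Γ_ℚ`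
(`X1Eleven.exists_modPCyclotomicCharacterZMod_five_ne_one`).  So the cyclotomic-determinant hypothesis
of the stub is load-bearing (the one a proof must use); it also shows that the interface
`WeierstrassCurve.IsTorsionGaloisRep` is not satisfiable by junk.

What this does NOT say: nothing against the stub as filed.
-/

-- `Summit.<Summit>.<Problem>`: for the single-conjunct summit `ABC` the duplicate `ABC.ABC` is mandated.
set_option linter.dupNamespace false

noncomputable section

open scoped MatrixGroups

open Literature.NumberTheory.GaloisRepresentations
open WeierstrassCurve

namespace Summit.ABC.ABC.Theorems.FreyModularity.Negative

/-- **The trivial representation is not `E[5]` of any elliptic curve over `ℚ`.**  By the Weil-pairing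
determinant `det ρ̄_{E,5} = χ̄₅` a trivial framed `ρ̄_{E,5}` would force `χ̄₅ ≡ 1` on `Γ_ℚ`, which fails
(a primitive fifth root of unity is moved by `Γ_ℚ`). [cite: SilvermanCSS1997, Ch. II §7 Proposition] -/
theorem not_isTorsionGaloisRep_five_one (W : WeierstrassCurve ℚ) [W.IsElliptic] :
    ¬ W.IsTorsionGaloisRep 5 (1 : ModPGaloisRep ℚ (ZMod 5) 2) := by
  intro h
  obtain ⟨σ, hσ⟩ :=
    Literature.NumberTheory.EllipticCurves.X1Eleven.exists_modPCyclotomicCharacterZMod_five_ne_one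
  apply hσ
  have hdet := W.det_eq_modPCyclotomicCharacter_of_isTorsionGaloisRep_holds 5
    (1 : ModPGaloisRep ℚ (ZMod 5) 2) h σ
  have h1 : (1 : ModPGaloisRep ℚ (ZMod 5) 2) σ = 1 := rfl
  rw [← hdet, h1, map_one]

/-- **`stub_switch` without its hypotheses on `ρ̄` is false** (witness `ρ̄ = 1`, by
`not_isTorsionGaloisRep_five_one`): it is NOT the case that every continuous `ρ̄ : Γ_ℚ →ₜ* GL₂(𝔽₅)` is
`E'[5]` for an elliptic curve `E'/ℚ` with surjective `ρ̄_{E',3}`.  The load-bearing hypothesis is the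
cyclotomic determinant. [folklore] -/
theorem stub_switch_false_without_det :
    ¬ ∀ ρ : ModPGaloisRep ℚ (ZMod 5) 2,
        ∃ (W : WeierstrassCurve ℚ) (_ : W.IsElliptic), W.IsTorsionGaloisRep 5 ρ ∧
          ∃ ρ₃ : ModPGaloisRep ℚ (ZMod 3) 2, W.IsTorsionGaloisRep 3 ρ₃ ∧ Function.Surjective ρ₃ :=
  fun h ↦ by
    obtain ⟨W, hW, h1, -⟩ := h 1
    exact not_isTorsionGaloisRep_five_one W h1

end Summit.ABC.ABC.Theorems.FreyModularity.Negative

end
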